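import Literature.AlgebraicGeometry.ShimuraVarieties.UnitaryShimuraCurveRecordMorphisms
import Literature.AlgebraicGeometry.ShimuraVarieties.UnitaryShimuraCurveLevelFibres
import Literature.AlgebraicGeometry.Motives.SepQuotientComparisonComplex
import Literature.AlgebraicGeometry.Motives.VarietiesGeometricallyIntegralProofs
import HarnessLib

/-!
# `M⋆_K = M⋆_N / (K/N)` for the levels of the canonical model of the unitary Shimura CURVE `Sh(U(J⋆), 𝔻)` —
# [Deligne1979ShimuraVarieties] 2.7.1 (c) PROVED for the curve record, modulo its Hecke translates (u4 ⇐ u1)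

Topic `AlgebraicGeometry/ShimuraVarieties`, namespace `Literature.AlgebraicGeometry.ShimuraVarieties.UnitaryCanonicalModel` (object: the
rank-2 record system `RecordSystemGS L Jstar τ K₀` of `UnitaryShimuraCurveRecord.lean`, cone coordinates).  PROOF FILE (theorems only; no
definition, no named fact, no instance, no `sorry`): the `3 ↦ 2` twin of ★ `RecordSystem.isLevelQuotient`
(`UnitaryShimuraLevelQuotientHolds.lean`, [Deligne1979ShimuraVarieties] 2.7.1 (c) «`(K/L)\S_L ⥲ S_K`»; [Milne2005ShimuraVarieties] Rem. 5.29 (c))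
for the CURVE: the predicate ★ `RecordSystemGS.IsLevelQuotient` (`UnitaryShimuraCurveRecordMorphisms.lean` §4, conjunct (u4) of the cited
cluster ★ `UnitaryCanonicalModel.exists_recordSystemGS`) is a THEOREM of the record's fields (F1) `smooth`/`projective`, (F2a) `pts`/`map_pts`,
(F2c) `pieces`, GIVEN the curve's Hecke translates over `L` (★ `RecordSystemGS.HeckeTranslateDefinedOver`, conjunct (u1) = [Milne2005ShimuraVarieties]
Thm. 13.6 for the curve), which enters as the HYPOTHESIS `hU` — the rank-3 proof consumed the proved U7 `heckeTranslate_definedOver_holds` at the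
same place; the day (u1) is a theorem for every curve record (`heckeTranslateDefinedOverGS_holds`), `S.isLevelQuotient` is one line from the head
below.

PROOF (`RecordSystemGS.isLevelQuotient_of_heckeTranslateDefinedOver`; the rank-3 proof verbatim with `3 ↦ 2`, ball ↦ cone coordinates).  Let
`N ≤ K ≤ K₀` be small levels with `N` normal in `K`, `p : M_N → M_K` the transition morphism.
* (E1) `K` acts on `M_N` by `act k := T_{k⁻¹}`, the translate `[v, aN] ↦ [v, ak⁻¹N]` over `L` (`hU`; `k N k⁻¹ = N`), a homomorphism
  `K → Aut_L(M_N)` by uniqueness of translates (★ `RecordSystemGS.heckeTranslate_unique`, `isHeckeTranslate_comp`, `heckeTranslate_eq_id_of_mem`);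
  it kills `N`, so factors through the FINITE group `Δ = K/N` (`N` open in the compact `K`).
* (E2) `p` is invariant: `T_{k⁻¹} ≫ p` and `p` are both translates `M_N → M_K` for `k⁻¹` (`[v, ak⁻¹K] = [v, aK]`, ★ `ShimuraSetGS.mk_mul_of_mem`).
* (E3) Mumford's quotient `π : M_N → Q := M_N/Δ` of the projective `M_N` (★ `Motives.autQuotient`) and the factorisation `r : Q → M_K` of `p`
  (`autQuotient.desc`): it suffices that `r` is an isomorphism (★ `isSepQuotient_of_isIso_desc`), and by fpqc descent that `r ⊗_{L,τ} ℂ` is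
  (★ `isIso_of_isIso_baseChangeHom_map`, [StacksProject, Tag 02L4]).
* (C) Over `ℂ`: `(M_K)_τ` is the coproduct of the smooth projective disc quotients `X_q` (field `pieces`, `UnitaryBallUniformisationDatum 1`),
  `Q_τ` is proper and reduced (★ `isReduced_baseChangeHom_autQuotient_left`), and `r_τ` is BIJECTIVE on complex points — point algebra on
  `Sh_K(ℂ) = U(J⋆)(L⁺)\[𝔻 × U(J⋆)(𝔸_{L⁺,f})/K]`: every complex point of `Q_τ` is `π_τ [v, aN]` (★ `map_baseChangeHom_autQuotientMk_surjective`,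
  ★ `RecordSystemGS.exists_eq_pts_symm_mk`), `r_τ π_τ = p_τ` acts by `[v, aN] ↦ [v, aK]` (`map_pts`), which is onto, and `[v, aK] = [v', a'K]`
  forces `[v', a'N] = [v, akN] = T_{k} [v, aN] = act k⁻¹ [v, aN]` for some `k ∈ K` (★ `ShimuraSetGS.mk_eq_mk_iff_exists_mem`), so the fibres of
  `p_τ` are `Δ`-orbits, on which `π_τ` is constant.  Hence `r_τ` is an isomorphism by the Zariski-Main-Theorem criterion over the pieces
  (★ `Motives.isIso_of_bijective_of_isColimit_cofan` at relative dimension `1`, [Springer1998] Thm. 5.2.8).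

Use (cell `hodgecm-mathlib`, GS programme; A-plan2 `GS-PROGRAMME.md` A.17 PART A″ (u4); A-p10 census `CENSUS-GS3-of-Mumford` §3 row L-u4):
a conjunct of the cited GS-3 cluster `exists_recordSystemGS` ([Milne2005ShimuraVarieties] Thm. 13.7 / [Deligne1979ShimuraVarieties] 2.2.6 for
the curve) proved from (u1) — one of the leaves that let GS-3 be re-keyed count-neutrally to «`∃ S`» alone.  Banked generic leaf, books 0;
HC_CM is proved only modulo the printed citations until rung 0 closes.

## References
* [Deligne1979ShimuraVarieties] P. Deligne, *Variétés de Shimura*, PSPM XXXIII.2 (1979): 2.1.2–2.1.4, 2.2.5, 2.7.1 (c) (Milne's translation,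
  PDF p. 47 L26–38).
* [Milne2005ShimuraVarieties] J. S. Milne, *Introduction to Shimura varieties* (2005; rev. 2017): Lemma 5.13 p. 57, Rem. 5.29 (c) p. 65,
  Thm. 13.6 p. 118.
* [MumfordAV1970] D. Mumford, *Abelian Varieties* (1970), §7 Thm. p. 66 and Remark (quotients by finite groups).
* [StacksProject] Tag 02L4; [Springer1998] T. A. Springer, *Linear Algebraic Groups*, Thm. 5.2.8; [GortzWedhorn2020] §(4.7).
-/

set_option autoImplicit false

noncomputable section

open Function MulAction Topology NumberField CategoryTheory CategoryTheory.Limits Matrix AlgebraicGeometry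
open scoped Matrix ComplexOrder
open Literature.AlgebraicGeometry.Motives
open Literature.NumberTheory.Automorphic Literature.NumberTheory.Automorphic.UnitaryGroup
open Literature.NumberTheory.Automorphic.Liu2021.AppendixC (C5.OpenCompactSubgroup C5.SmallLevel)
open Literature.NumberTheory.Automorphic.ShimuraDissection

namespace Literature.AlgebraicGeometry.ShimuraVarieties.UnitaryCanonicalModel

variable {L : Type} [Field L] [NumberField L] [IsCMField L] {Jstar : Matrix (Fin 2) (Fin 2) L} {τ : L →+* ℂ}
  {K₀ : C5.OpenCompactSubgroup ↥(finAdelic (↥(maximalRealSubfield L)) L (IsCMField.complexConj L) 2 Jstar)}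

/-! ## §0 Complex points of the curve's models along `τ` and their base change -/

omit [NumberField L] [IsCMField L] in
/-- Naturality of `X(ℂ) ⥲ X_τ(ℂ)` (`AlgPoints.baseChangeEquiv`) in the `L`-scheme `X`: `(x ≫ f)_τ = x_τ ≫ f_τ` (pullback extensionality; the
same two-line proof as the private rank-3 lemma of `UnitaryShimuraLevelQuotientHolds.lean`). [cite: GortzWedhorn2020, §(4.7) eq. (4.7.1)] -/
private theorem baseChangeEquiv_map_gs {X Y : SchemeOver L} (f : X ⟶ Y) (x : letI := τ.toAlgebra; ComplexPoints X) :
    (letI := τ.toAlgebra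
     AlgPoints.baseChangeEquiv τ Y (AlgPoints.map f x) = AlgPoints.map ((baseChangeHom τ).map f) (AlgPoints.baseChangeEquiv τ X x)) := by
  letI : Algebra L ℂ := τ.toAlgebra
  rw [Equiv.apply_eq_iff_eq_symm_apply]
  apply Over.OverMorphism.ext
  rw [AlgPoints.baseChangeEquiv_symm_apply_left, AlgPoints.map_apply, Over.comp_left, AlgPoints.map_apply, Over.comp_left,
    Category.assoc, baseChangeHom_map_left_comp_fst, ← Category.assoc, AlgPoints.baseChangeEquiv_apply_left_comp_fst]
  rfl

/-- **Every complex point of `(M⋆_K)_τ` is `[v, aK]`** for a negative vector `v` of `J⋆^τ` and `a ∈ U(J⋆)(𝔸_{L⁺,f})` (★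
`RecordSystemGS.exists_eq_pts_symm_mk` moved to the base change by `AlgPoints.baseChangeEquiv`). [cite: Milne2005ShimuraVarieties, Lemma 5.13 p. 57] -/
theorem RecordSystemGS.exists_eq_baseChangeEquiv_pts_symm_mk (S : RecordSystemGS L Jstar τ K₀) (K : C5.SmallLevel K₀)
    (y : ComplexPoints ((baseChangeHom τ).obj (S.M.obj K))) :
    letI := τ.toAlgebra
    ∃ (v : Fin 2 → ℂ) (hv : v ∈ negCone (Jstar.map τ)) (a : ↥(finAdelic (↥(maximalRealSubfield L)) L (IsCMField.complexConj L) 2 Jstar)),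
      y = AlgPoints.baseChangeEquiv τ (S.M.obj K) ((S.pts K).symm (ShimuraSetGS.mk L Jstar τ K.1.1 v hv a)) := by
  letI : Algebra L ℂ := τ.toAlgebra
  obtain ⟨y₀, rfl⟩ := (AlgPoints.baseChangeEquiv τ (S.M.obj K)).surjective y
  obtain ⟨v, hv, a, rfl⟩ := S.exists_eq_pts_symm_mk K y₀
  exact ⟨v, hv, a, rfl⟩

/-- **A translate `T_g : M⋆_K ⟶ M⋆_{K'}` acts on the base-changed points as `[v, aK] ↦ [v, agK']`.**
[cite: Milne2005ShimuraVarieties, §13 p. 118 L21–26] -/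
theorem RecordSystemGS.IsHeckeTranslate.map_baseChange {S : RecordSystemGS L Jstar τ K₀} {K K' : C5.SmallLevel K₀}
    {g : ↥(finAdelic (↥(maximalRealSubfield L)) L (IsCMField.complexConj L) 2 Jstar)} {Tg : S.M.obj K ⟶ S.M.obj K'}
    (h : S.IsHeckeTranslate K K' g Tg) (v : Fin 2 → ℂ) (hv : v ∈ negCone (Jstar.map τ))
    (a : ↥(finAdelic (↥(maximalRealSubfield L)) L (IsCMField.complexConj L) 2 Jstar)) :
    letI := τ.toAlgebra
    AlgPoints.map ((baseChangeHom τ).map Tg) (AlgPoints.baseChangeEquiv τ (S.M.obj K) ((S.pts K).symm (ShimuraSetGS.mk L Jstar τ K.1.1 v hv a))) =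
      AlgPoints.baseChangeEquiv τ (S.M.obj K') ((S.pts K').symm (ShimuraSetGS.mk L Jstar τ K'.1.1 v hv (a * g))) := by
  letI : Algebra L ℂ := τ.toAlgebra
  rw [← baseChangeEquiv_map_gs, ← h v hv a, Homeomorph.symm_apply_apply]

/-! ## §1 The theorem: (u4) from (u1) -/

set_option maxHeartbeats 1600000 in -- large adelic / Shimura-set terms (as the rank-3 twin)
/-- **[Deligne1979ShimuraVarieties] 2.7.1 (c) for the curve record: `M⋆_K = M⋆_N/(K/N)`, GIVEN the Hecke translates over `L`.**  Every record
system `S` of the models of `Sh(U(J⋆), 𝔻)` whose Hecke translates are defined over `L` (`hU : S.HeckeTranslateDefinedOver`, conjunct (u1),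
[Milne2005ShimuraVarieties] Thm. 13.6) satisfies ★ `RecordSystemGS.IsLevelQuotient` (conjunct (u4)): for small levels `N ≤ K` with `N` normal
in `K`, `K` acts on `M⋆_N` through the translates `T_{k⁻¹}` and the transition morphism `M⋆_N ⟶ M⋆_K` is the quotient by this action for
separated test objects.  Proof in the module docstring: comparison with Mumford's quotient `M⋆_N/(K/N)`, fpqc descent of «isomorphism» to
`ℂ`, and over `ℂ` the double-coset bookkeeping `Sh_K(ℂ) = Sh_N(ℂ)/(K/N)` (★ `ShimuraSetGS.mk_eq_mk_iff_exists_mem`) plus Zariski's Main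
Theorem over the disc-quotient pieces.  The `3 ↦ 2` twin of ★ `RecordSystem.isLevelQuotient` with (u1) as a hypothesis in place of the
rank-3 theorem U7. [cite: Deligne1979ShimuraVarieties, 2.7.1 (c) (PDF p. 47 L34–38) and 2.1.2–2.1.4]
[cite: Milne2005ShimuraVarieties, Rem. 5.29 (c) p. 65; Lemma 5.13 p. 57; Thm. 13.6 p. 118] [cite: MumfordAV1970, §7 Thm. p. 66 (Remark)] -/
theorem RecordSystemGS.isLevelQuotient_of_heckeTranslateDefinedOver (S : RecordSystemGS L Jstar τ K₀)
    (hU : S.HeckeTranslateDefinedOver) : S.IsLevelQuotient := by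
  intro N K h hNK
  letI : Algebra L ℂ := τ.toAlgebra
  classical
  -- notation
  let G := finAdelic (↥(maximalRealSubfield L)) L (IsCMField.complexConj L) 2 Jstar
  let Kg : Subgroup G := K.1.1
  let Ng : Subgroup Kg := N.1.1.subgroupOf K.1.1
  have hmemNg : ∀ x : Kg, x ∈ Ng ↔ (x : G) ∈ N.1.1 := fun x => Subgroup.mem_subgroupOf
  haveI hNn : Ng.Normal := ⟨fun n hn' g => by
    rw [hmemNg] at hn' ⊢
    have h1 := hNK ((g⁻¹ : Kg) : G) (g⁻¹).2 (n : G) hn'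
    simpa only [Subgroup.coe_inv, inv_inv, Subgroup.coe_mul] using h1⟩
  haveI : CompactSpace Kg := isCompact_iff_compactSpace.1 K.1.2.2
  have hNo : IsOpen (Ng : Set Kg) := N.1.2.1.preimage continuous_subtype_val
  haveI : Finite (Kg ⧸ Ng) := Subgroup.quotient_finite_of_isOpen Ng hNo
  letI : Fintype (Kg ⧸ Ng) := Fintype.ofFinite _
  have hinv : ∀ {k : G}, k ∈ K.1.1 → k⁻¹ ∈ K.1.1 := fun hk => K.1.1.inv_mem hk
  have hNK' : N.1.1 ≤ K.1.1 := fun x hx => (show N.1 ≤ K.1 from h) hx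
  -- (E1) the translates `T_{k⁻¹}`, `k ∈ K`, defined over `L` (u1, the hypothesis `hU`)
  have hex : ∀ k : Kg, ∃ Tk : S.M.obj N ⟶ S.M.obj N, S.IsHeckeTranslate N N ((k : G)⁻¹) Tk := fun k =>
    hU ((k : G)⁻¹) N N (fun n hn => hNK _ (hinv k.2) n hn)
  choose Tr hTr using hex
  have hTr1 : ∀ (k : Kg), (k : G) ∈ N.1.1 → Tr k = 𝟙 (S.M.obj N) := fun k hk =>
    S.heckeTranslate_eq_id_of_mem (N.1.1.inv_mem hk) (hTr k)
  have hTrmul : ∀ a b : Kg, Tr (a * b) = Tr b ≫ Tr a := fun a b => by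
    refine S.heckeTranslate_unique (hTr (a * b)) ?_
    have e : (((a * b : Kg) : G))⁻¹ = ((b : G))⁻¹ * ((a : G))⁻¹ := by rw [Subgroup.coe_mul, _root_.mul_inv_rev]
    rw [e]
    exact S.isHeckeTranslate_comp (hTr b) (hTr a)
  have hTrone : Tr 1 = 𝟙 (S.M.obj N) := hTr1 1 (by rw [Subgroup.coe_one]; exact N.1.1.one_mem)
  have hTT : ∀ k : Kg, Tr k ≫ Tr k⁻¹ = 𝟙 (S.M.obj N) := fun k => by rw [← hTrmul, inv_mul_cancel, hTrone]
  have hTT' : ∀ k : Kg, Tr k⁻¹ ≫ Tr k = 𝟙 (S.M.obj N) := fun k => by rw [← hTrmul, mul_inv_cancel, hTrone]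
  let act : Kg →* Aut (S.M.obj N) :=
    { toFun := fun k => ⟨Tr k, Tr k⁻¹, hTT k, hTT' k⟩
      map_one' := Iso.ext hTrone
      map_mul' := fun a b => Iso.ext (hTrmul a b) }
  have act_hom : ∀ k : Kg, (act k).hom = Tr k := fun _ => rfl
  -- it kills `N`: descend to the finite group `Δ = K/N`
  have hker : ∀ n ∈ Ng, act n = 1 := fun n hn' => Iso.ext (by rw [act_hom]; exact hTr1 n ((hmemNg n).1 hn'))
  let actΔ : (Kg ⧸ Ng) →* Aut (S.M.obj N) := QuotientGroup.lift Ng act hker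
  have actΔ_mk : ∀ k : Kg, actΔ (QuotientGroup.mk k) = act k := fun _ => rfl
  -- (E2) the transition morphism `p : M_N → M_K` is invariant
  let p : S.M.obj N ⟶ S.M.obj K := S.M.map (homOfLE h)
  have hp1 : S.IsHeckeTranslate N K 1 p := S.isHeckeTranslate_one_map (homOfLE h)
  have hinvK : ∀ k : Kg, (act k).hom ≫ p = p := by
    intro k
    refine S.heckeTranslate_unique (S.isHeckeTranslate_comp (hTr k) hp1) ?_
    intro v hv a
    rw [hp1 v hv a, mul_one, mul_one, ShimuraSetGS.mk_mul_of_mem L Jstar τ K.1.1 v hv a (hinv k.2)]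
  have hinvΔ : ∀ g : Kg ⧸ Ng, (actΔ g).hom ≫ p = p := fun g => by
    obtain ⟨k, rfl⟩ := QuotientGroup.mk_surjective g
    exact hinvK k
  -- (E3) Mumford's quotient `Q = M_N/Δ` and the comparison `r : Q → M_K`
  have hY : IsProjectiveOver (S.M.obj N) := S.projective N
  have hZ : IsSeparated (S.M.obj K).hom := by
    haveI := (S.projective K).isProper; infer_instance
  let r := autQuotient.desc actΔ hY p hZ hinvΔ
  have hπr : autQuotient.mk actΔ hY ≫ r = p := autQuotient.mk_desc actΔ hY p hZ hinvΔ
  -- it suffices that `r ⊗_τ ℂ` is an isomorphism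
  suffices hiso : IsIso ((baseChangeHom τ).map r) by
    haveI : IsIso r := isIso_of_isIso_baseChangeHom_map τ r
    have hq : IsSepQuotient (fun g => actΔ g) p := isSepQuotient_of_isIso_desc hY actΔ p hZ hinvΔ
    refine ⟨act, fun k => hTr k, ⟨fun k => hinvK k, fun W f hW hf => hq.2 W f hW fun g => ?_⟩⟩
    obtain ⟨k, rfl⟩ := QuotientGroup.mk_surjective g
    exact hf k
  -- (C) over `ℂ`: instances for `Q_τ`, `(M_N)_τ`, `(M_K)_τ`
  haveI := smoothOfRelativeDimension_isStableUnderBaseChange (n := 1)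
  haveI hsmN : SmoothOfRelativeDimension 1 ((baseChangeHom τ).obj (S.M.obj N)).hom := by
    change SmoothOfRelativeDimension 1 (pullback.snd (S.M.obj N).hom (Spec.map (CommRingCat.ofHom τ)))
    exact MorphismProperty.pullback_snd _ _ (S.smooth N)
  haveI : Smooth ((baseChangeHom τ).obj (S.M.obj N)).hom := SmoothOfRelativeDimension.smooth 1 _
  haveI : IsReduced ((baseChangeHom τ).obj (S.M.obj N)).left := isReduced_of_smooth_over_field ((baseChangeHom τ).obj (S.M.obj N)).hom
  haveI : IsReduced ((baseChangeHom τ).obj (autQuotient actΔ hY)).left := isReduced_baseChangeHom_autQuotient_left τ hY actΔ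
  haveI : IsProper ((baseChangeHom τ).obj (autQuotient actΔ hY)).hom := by
    haveI := autQuotient.isProper_hom actΔ hY
    change IsProper (pullback.snd (autQuotient actΔ hY).hom (Spec.map (CommRingCat.ofHom τ)))
    infer_instance
  haveI : IsSeparated ((baseChangeHom τ).obj (S.M.obj K)).hom :=
    isSeparated_baseChangeHom_hom_of_isProjectiveOver τ (S.projective K)
  -- the pieces of `(M_K)_τ`
  obtain ⟨gK, hgK, X, ι, hcol, B, hB⟩ := S.pieces K
  -- complex points: `r_τ ∘ π_τ = p_τ`; `p_τ [v, aN] = [v, aK]`; `T_τ [v, aN] = [v, a k⁻¹ N]`; `π_τ` onto and invariant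
  have hcomp : (baseChangeHom τ).map (autQuotient.mk actΔ hY) ≫ (baseChangeHom τ).map r = (baseChangeHom τ).map p := by
    rw [← Functor.map_comp, hπr]
  have hpτ : ∀ (v : Fin 2 → ℂ) (hv : v ∈ negCone (Jstar.map τ)) (a : G), AlgPoints.map ((baseChangeHom τ).map p)
      (AlgPoints.baseChangeEquiv τ (S.M.obj N) ((S.pts N).symm (ShimuraSetGS.mk L Jstar τ N.1.1 v hv a))) =
      AlgPoints.baseChangeEquiv τ (S.M.obj K) ((S.pts K).symm (ShimuraSetGS.mk L Jstar τ K.1.1 v hv a)) := fun v hv a => by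
    rw [hp1.map_baseChange, mul_one]
  have hTτ : ∀ (k : Kg) (v : Fin 2 → ℂ) (hv : v ∈ negCone (Jstar.map τ)) (a : G),
      AlgPoints.map ((baseChangeHom τ).map (act k).hom)
        (AlgPoints.baseChangeEquiv τ (S.M.obj N) ((S.pts N).symm (ShimuraSetGS.mk L Jstar τ N.1.1 v hv a))) =
      AlgPoints.baseChangeEquiv τ (S.M.obj N) ((S.pts N).symm (ShimuraSetGS.mk L Jstar τ N.1.1 v hv (a * (k : G)⁻¹))) :=
    fun k v hv a => (hTr k).map_baseChange v hv a
  have hπinv : ∀ k : Kg, (baseChangeHom τ).map (act k).hom ≫ (baseChangeHom τ).map (autQuotient.mk actΔ hY) =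
      (baseChangeHom τ).map (autQuotient.mk actΔ hY) := fun k => by
    rw [← Functor.map_comp, ← actΔ_mk, autQuotient.hom_mk]
  have hπsurj := map_baseChangeHom_autQuotientMk_surjective τ hY actΔ
  -- `r_τ` is bijective on complex points
  have hbij : Function.Bijective (AlgPoints.map (L := ℂ) ((baseChangeHom τ).map r)) := by
    constructor
    · intro a₁ a₂ h₁₂
      obtain ⟨P₁, rfl⟩ := hπsurj a₁
      obtain ⟨P₂, rfl⟩ := hπsurj a₂
      obtain ⟨v₁, hv₁, b₁, rfl⟩ := S.exists_eq_baseChangeEquiv_pts_symm_mk N P₁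
      obtain ⟨v₂, hv₂, b₂, rfl⟩ := S.exists_eq_baseChangeEquiv_pts_symm_mk N P₂
      -- `[v₁, b₁K] = [v₂, b₂K]`
      have hK : ShimuraSetGS.mk L Jstar τ K.1.1 v₁ hv₁ b₁ = ShimuraSetGS.mk L Jstar τ K.1.1 v₂ hv₂ b₂ := by
        have h' := h₁₂
        rw [← AlgPoints.map_comp_apply, ← AlgPoints.map_comp_apply, hcomp, hpτ, hpτ] at h'
        exact (S.pts K).symm.injective ((AlgPoints.baseChangeEquiv τ (S.M.obj K)).injective h')
      -- `[v₂, b₂N] = [v₁, b₁ k N] = act k⁻¹ [v₁, b₁N]` for some `k ∈ K`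
      obtain ⟨k₀, hk₀, hN₀⟩ := (ShimuraSetGS.mk_eq_mk_iff_exists_mem L Jstar τ hNK' v₁ v₂ hv₁ hv₂ b₁ b₂).1 hK
      let k : Kg := ⟨k₀, hk₀⟩
      have hN : ShimuraSetGS.mk L Jstar τ N.1.1 v₂ hv₂ b₂ =
          ShimuraSetGS.mk L Jstar τ N.1.1 v₁ hv₁ (b₁ * (((k⁻¹ : Kg) : G))⁻¹) := by
        rw [Subgroup.coe_inv, inv_inv]
        exact hN₀
      have hP : AlgPoints.baseChangeEquiv τ (S.M.obj N) ((S.pts N).symm (ShimuraSetGS.mk L Jstar τ N.1.1 v₂ hv₂ b₂)) =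
          AlgPoints.map ((baseChangeHom τ).map (act k⁻¹).hom)
            (AlgPoints.baseChangeEquiv τ (S.M.obj N) ((S.pts N).symm (ShimuraSetGS.mk L Jstar τ N.1.1 v₁ hv₁ b₁))) := by
        rw [hTτ, hN]
      rw [hP, ← AlgPoints.map_comp_apply, hπinv]
    · intro y
      obtain ⟨v, hv, a, rfl⟩ := S.exists_eq_baseChangeEquiv_pts_symm_mk K y
      refine ⟨AlgPoints.map ((baseChangeHom τ).map (autQuotient.mk actΔ hY))
        (AlgPoints.baseChangeEquiv τ (S.M.obj N) ((S.pts N).symm (ShimuraSetGS.mk L Jstar τ N.1.1 v hv a))), ?_⟩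
      rw [← AlgPoints.map_comp_apply, hcomp, hpτ]
  exact isIso_of_bijective_of_isColimit_cofan ((baseChangeHom τ).map r) ι (fun _ => 1) (fun q => (B q).isSmoothProjective) hcol hbij

end Literature.AlgebraicGeometry.ShimuraVarieties.UnitaryCanonicalModel

end
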